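import Summits.ValiantsHypothesis.ValiantsHypothesis.Theorems.BarrierLeverChowThinRowsLabelledPairsPrelims
import Summits.ValiantsHypothesis.ValiantsHypothesis.Theorems.BarrierLeverChowThinRowsSubcubeBasis

/-!
# Route BarrierLever — item `ChowHitsThinRowPartitionMinors` (stmt-ValiantsHypothesis-20195):
# the PAIR LAYER on down-closed column families, I — union-labelled layouts (the triangular half)

Helper file (`--supports stmt-ValiantsHypothesis-20195`; cell valiant-natproofs, rung V4, 𝒟-side of
door (c); prover seat val-np-p8 gen 0).  Closes NO item; imports only the seat's predecessors'
helper files `…ChowThinRowsLabelledPairsPrelims` (this seat) / `…ChowThinRowsSubcubeBasis` (prover g10; no route file).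
Conventions as there: `x_a = X (castAdd h a)`, `y_c = X (natAdd h c)`, the partition-matrix entry of
`f` at `(u, w)` is `coeff (E u w) f`, `E u w = Σ_{a∈u} single (castAdd h a) 1 + Σ_{c∈w} single (natAdd h c) 1`,
and the witness family is the product of the INDICATOR FORMS `φ_V = 1 + Σ_a κ_a(V) x_a + Σ_{c∈V} y_c`,
`V ∈ 𝒟`, of a down-closed family `𝒟` of at most `h + h` subsets of `Fin h`.

**Theorem `chowHits_thinRows_of_unionLabelling` (rows of size ≤ 2).**  Let `𝒟` be down-closed with
`|𝒟| ≤ h + h`, and let the layout `(u, w)` have injective thin rows (`|u i| ≤ 2`) and, as columns, ALL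
of `𝒟` (injectively).  Suppose the layout is UNION-LABELLED: there is `L : Fin h → Finset (Fin h)` with
`⋃_{a ∈ u i} L a = w i` for every `i`, the (at most two) labels inside a row being distinct.  Then ONE
explicit product of `h + h` affine forms — the `x`-DIAGONAL indicator design `κ_a(V) = [V = L a]`, i.e.
`x_a` placed in the single form `φ_{L a}` — makes the partition minor nonsingular, at every height.
Mechanism (memo THINROWS-MEMO-g10 §6, «union-injective labelling», made polynomial-exact and for
every down-closed `𝒟`, not only cubes): with the truncated inverses `t_V = Σ_{U⊆V} (-1)^{|U|}|U|! y^U`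
(`coeff_tinv`, `coeff_leaveOneOut`), the row `u i` of the design is `B⁰ · ∏_{a ∈ u i} t_{L a}` on
squarefree monomials (`coeff_xdiag_row` of the prelims file: the first/second-order derivative formulas
`coeff_single_prod` / `coeff_pair_prod` collapse to leave-one/two-out products); the `t`-products are
supported below `⋃ L a = w i` with a SIGN-DEFINITE, hence nonzero, top coefficient
(`coeff_tprod_subset`, `coeff_tprod_signed`); so the minor factors as `P · Λ` with `P` lower- and `Λ`
unit-upper-triangular once the columns are sorted by cardinality (`Tuple.sort`).  The determinant
step is isolated as a reusable TRIANGULAR-DESIGN CRITERION `det_ne_zero_of_triangularDesign` (any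
design whose rows are `B⁰ · ρ_i` with `ρ_i` `y`-only, nonzero at `y^{w i}` and otherwise supported on
columns of smaller cardinality, has nonzero partition minor on the full down-closed column family).
Corollary `chowHits_principalThinMinors_of_downClosed`: every PRINCIPAL thin minor `[𝒰, 𝒰]`
(`𝒰` a down-closed family of at most `h + h` sets of size `≤ 2`, i.e. a graph complex: `∅`, vertices,
edges) is Chow-hit at every height (labels `L a = {a}`).

WHAT THIS IS NOT: the generic pair layer (Conjecture DC of the memo: ALL thin row families against a
down-closed column family) is NOT proved here — union-labelled layouts are its triangular half (the
capacity-critical layout `Thin([5]) × 2^{[4]}` has no union labelling); nothing on items 20195 /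
20172 / 19717 themselves, on crux stmt-ValiantsHypothesis-14610, or on `VP` versus `VNP`.
-/

set_option linter.dupNamespace false

namespace Summit.ValiantsHypothesis.ValiantsHypothesis.Theorems.BarrierLever.ChowSubcube

open Finset MvPolynomial
open Summit.ValiantsHypothesis.ValiantsHypothesis.Theorems.BarrierLever.ChowFactor
  (coeff_partitionExpo_mul_affine coeff_partitionExpo_mul_yOnly totalDegree_affine_le)
open Summit.ValiantsHypothesis.ValiantsHypothesis.Theorems.BarrierLever.ProductStateSums
  (castAdd_ne_natAdd partitionExpo_apply_castAdd partitionExpo_apply_natAdd)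
open Summit.ValiantsHypothesis.ValiantsHypothesis.Theorems.BarrierLever.CorankRepair (partitionExpo_eq_iff)

variable {h : ℕ}

/-! ## 3. A triangular-design criterion -/

/-- **Triangular-design criterion.**  Let the columns `w` enumerate all of a down-closed family `𝒟`,
sorted by cardinality.  Suppose every row `i` of the partition matrix of `F` is, on squarefree
monomials, `B⁰ · ρ_i` for a `y`-only `ρ_i` (`B⁰` with constant term `1`), where `ρ_i` has a nonzero
coefficient at `y^{w i}` and its other nonzero coefficients `y^{w k}` have `|w k| < |w i|`.  Then the
partition minor is nonzero: it factors as `P · Λ` with `P = [coeff_{y^{w k}} ρ_i]` lower triangular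
(nonzero diagonal) and `Λ = [ [w k ⊆ w j] · coeff_{y^{w j ∖ w k}} B⁰ ]` unit upper triangular. -/
theorem det_ne_zero_of_triangularDesign (DD : Finset (Finset (Fin h)))
    (hDD : ∀ W ∈ DD, ∀ U : Finset (Fin h), U ⊆ W → U ∈ DD)
    (r : ℕ) (u w : Fin r → Finset (Fin h)) (hw : Function.Injective w)
    (hwD : ∀ j, w j ∈ DD) (hsurj : ∀ V ∈ DD, ∃ j, w j = V)
    (hmono : Monotone fun j => (w j).card)
    (F B0 : MvPolynomial (Fin (h + h)) ℂ)
    (hB0 : coeff (∑ a ∈ (∅ : Finset (Fin h)), Finsupp.single (Fin.castAdd h a) 1 +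
      ∑ c ∈ (∅ : Finset (Fin h)), Finsupp.single (Fin.natAdd h c) 1) B0 = 1)
    (ρ : Fin r → MvPolynomial (Fin (h + h)) ℂ)
    (hρy : ∀ i, ∀ s ∈ (ρ i).support, ∀ a : Fin h, s (Fin.castAdd h a) = 0)
    (hrow : ∀ i j, coeff (∑ a ∈ u i, Finsupp.single (Fin.castAdd h a) 1 +
        ∑ c ∈ w j, Finsupp.single (Fin.natAdd h c) 1) F =
      coeff (∑ a ∈ (∅ : Finset (Fin h)), Finsupp.single (Fin.castAdd h a) 1 +
        ∑ c ∈ w j, Finsupp.single (Fin.natAdd h c) 1) (B0 * ρ i))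
    (hρsupp : ∀ i k, coeff (∑ a ∈ (∅ : Finset (Fin h)), Finsupp.single (Fin.castAdd h a) 1 +
        ∑ c ∈ w k, Finsupp.single (Fin.natAdd h c) 1) (ρ i) ≠ 0 → (w k).card < (w i).card ∨ k = i)
    (hρdiag : ∀ i, coeff (∑ a ∈ (∅ : Finset (Fin h)), Finsupp.single (Fin.castAdd h a) 1 +
        ∑ c ∈ w i, Finsupp.single (Fin.natAdd h c) 1) (ρ i) ≠ 0) :
    (Matrix.of fun i j : Fin r => MvPolynomial.coeff
        (∑ a ∈ u i, Finsupp.single (Fin.castAdd h a) 1 +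
          ∑ c ∈ w j, Finsupp.single (Fin.natAdd h c) 1) F).det ≠ 0 := by
  classical
  set P : Matrix (Fin r) (Fin r) ℂ := Matrix.of fun i k =>
    coeff (∑ a ∈ (∅ : Finset (Fin h)), Finsupp.single (Fin.castAdd h a) 1 +
      ∑ c ∈ w k, Finsupp.single (Fin.natAdd h c) 1) (ρ i) with hP
  set Λ : Matrix (Fin r) (Fin r) ℂ := Matrix.of fun k j =>
    if w k ⊆ w j then coeff (∑ a ∈ (∅ : Finset (Fin h)), Finsupp.single (Fin.castAdd h a) 1 +
      ∑ c ∈ w j \ w k, Finsupp.single (Fin.natAdd h c) 1) B0 else 0 with hΛ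
  -- Step A: the factorisation `M = P * Λ`
  have hfac : (Matrix.of fun i j : Fin r => MvPolynomial.coeff
        (∑ a ∈ u i, Finsupp.single (Fin.castAdd h a) 1 +
          ∑ c ∈ w j, Finsupp.single (Fin.natAdd h c) 1) F) = P * Λ := by
    ext i j
    rw [Matrix.of_apply, Matrix.mul_apply, hrow i j,
      coeff_partitionExpo_mul_yOnly _ _ (hρy i) ∅ (w j)]
    -- reindex the sum over `d ⊆ w j` by the column `k` with `w k = d`
    have hrhs : ∑ k, P i k * Λ k j = ∑ k ∈ Finset.univ.filter (fun k => w k ⊆ w j),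
        coeff (∑ a ∈ (∅ : Finset (Fin h)), Finsupp.single (Fin.castAdd h a) 1 +
            ∑ c ∈ w j \ w k, Finsupp.single (Fin.natAdd h c) 1) B0 *
          coeff (∑ a ∈ (∅ : Finset (Fin h)), Finsupp.single (Fin.castAdd h a) 1 +
            ∑ c ∈ w k, Finsupp.single (Fin.natAdd h c) 1) (ρ i) := by
      rw [Finset.sum_filter]
      refine Finset.sum_congr rfl fun k _ => ?_
      simp only [hP, hΛ, Matrix.of_apply]
      split_ifs <;> ring
    rw [hrhs]
    symm
    refine Finset.sum_bij (fun k _ => w k) ?_ ?_ ?_ ?_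
    · intro k hk
      rw [Finset.mem_filter] at hk
      exact Finset.mem_powerset.mpr hk.2
    · intro k₁ hk₁ k₂ hk₂ e
      exact hw e
    · intro d hd
      rw [Finset.mem_powerset] at hd
      obtain ⟨k, hk⟩ := hsurj d (hDD (w j) (hwD j) d hd)
      exact ⟨k, Finset.mem_filter.mpr ⟨Finset.mem_univ _, hk ▸ hd⟩, hk⟩
    · intro k hk
      rfl
  -- Step B: `Λ` is unit upper triangular
  have hΛtri : Λ.BlockTriangular id := by
    intro i j hij
    simp only [hΛ, Matrix.of_apply]
    rw [if_neg]
    intro hsub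
    have hle : (w j).card ≤ (w i).card := hmono (le_of_lt hij)
    have heq : w i = w j := Finset.eq_of_subset_of_card_le hsub hle
    exact (ne_of_lt hij).symm (hw heq)
  have hΛdet : Λ.det = 1 := by
    rw [Matrix.det_of_upperTriangular hΛtri]
    refine Finset.prod_eq_one fun i _ => ?_
    simp only [hΛ, Matrix.of_apply, if_pos (subset_refl _), Finset.sdiff_self]
    exact hB0
  -- Step C: `P` is lower triangular with nonzero diagonal
  have hPtri : P.BlockTriangular OrderDual.toDual := by
    intro i j hij
    have hij' : i < j := hij
    simp only [hP, Matrix.of_apply]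
    by_contra hne
    rcases hρsupp i j hne with hlt | heq
    · exact absurd (hmono (le_of_lt hij')) (not_le.mpr hlt)
    · exact (ne_of_lt hij') heq.symm
  have hPdet : P.det ≠ 0 := by
    rw [Matrix.det_of_lowerTriangular P hPtri]
    refine Finset.prod_ne_zero_iff.mpr fun i _ => ?_
    simp only [hP, Matrix.of_apply]
    exact hρdiag i
  -- Step D
  rw [hfac, Matrix.det_mul, hΛdet, mul_one]
  exact hPdet

/-! ## 4. The union-labelled pair layer -/

/-- **Determinant of the union-labelled layout, columns sorted by cardinality**: the `x`-diagonal
indicator design `κ_a(V) = [V = L a]` is a triangular design with `ρ_i = ∏_{a ∈ u i} t_{L a}`. -/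
theorem det_xdiag_ne_zero_of_monotone (DD : Finset (Finset (Fin h)))
    (hDD : ∀ W ∈ DD, ∀ U : Finset (Fin h), U ⊆ W → U ∈ DD)
    (r : ℕ) (u w : Fin r → Finset (Fin h)) (hw : Function.Injective w)
    (hu2 : ∀ i, (u i).card ≤ 2) (hwD : ∀ j, w j ∈ DD) (hsurj : ∀ V ∈ DD, ∃ j, w j = V)
    (hmono : Monotone fun j => (w j).card)
    (L : Fin h → Finset (Fin h)) (hLab : ∀ i, (u i).biUnion L = w i)
    (hLinj : ∀ i, ∀ a ∈ u i, ∀ b ∈ u i, L a = L b → a = b) :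
    (Matrix.of fun i j : Fin r => MvPolynomial.coeff
        (∑ a ∈ u i, Finsupp.single (Fin.castAdd h a) 1 +
          ∑ c ∈ w j, Finsupp.single (Fin.natAdd h c) 1)
        (∏ V ∈ DD, (C 1 + ∑ a, C ((fun a V => if V = L a then (1 : ℂ) else 0) a V) * X (Fin.castAdd h a) +
          ∑ c, C (if c ∈ V then (1 : ℂ) else 0) * X (Fin.natAdd h c)))).det ≠ 0 := by
  classical
  -- labels lie in `DD` (down-closure) since `L a ⊆ ⋃ L = w i ∈ DD`
  have hL : ∀ i, ∀ a ∈ u i, L a ∈ DD := fun i a ha =>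
    hDD (w i) (hwD i) (L a) (by rw [← hLab i]; exact Finset.subset_biUnion_of_mem L ha)
  refine det_ne_zero_of_triangularDesign DD hDD r u w hw hwD hsurj hmono _
    (∏ V' ∈ DD, (C 1 + ∑ a, C ((fun (_ : Fin h) (_ : Finset (Fin h)) => (0 : ℂ)) a V') * X (Fin.castAdd h a) +
      ∑ c, C (if c ∈ V' then (1 : ℂ) else 0) * X (Fin.natAdd h c)))
    (coeff_empty_empty_prod _ _)
    (fun i => ∏ a ∈ u i, ∑ U ∈ (L a).powerset,
      monomial (∑ a' ∈ (∅ : Finset (Fin h)), Finsupp.single (Fin.castAdd h a') 1 +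
        ∑ c ∈ U, Finsupp.single (Fin.natAdd h c) 1) ((-1 : ℂ) ^ U.card * (U.card.factorial : ℂ)))
    (fun i => yOnly_prod (u i) _ fun a _ => yOnly_tinv (L a))
    (fun i j => coeff_xdiag_row DD _ L (u i) (hu2 i) (hL i) (hLinj i) (fun a _ V _ => rfl) (w j))
    (fun i k hne => ?_) (fun i => ?_)
  · -- support: `w k ⊆ ⋃ L = w i`
    have hsub : w k ⊆ w i := by
      rw [← hLab i]
      exact coeff_tprod_subset (u i) L (w k) hne
    rcases (Finset.card_le_card hsub).lt_or_eq with hlt | heq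
    · exact Or.inl hlt
    · exact Or.inr (hw (Finset.eq_of_subset_of_card_le hsub heq.ge))
  · -- diagonal: sign-definite top coefficient
    obtain ⟨n, hn, hn1⟩ := coeff_tprod_signed (u i) L (w i)
    rw [hn]
    have h1 : 1 ≤ n := hn1 (hLab i).symm
    exact mul_ne_zero (pow_ne_zero _ (by norm_num)) (by exact_mod_cast (by omega : n ≠ 0))

/-- **PAIR LAYER, UNION-LABELLED LAYOUTS — thin rows × all of a small down-closed column family,
every height** (item `ChowHitsThinRowPartitionMinors`, stmt-ValiantsHypothesis-20195, on that
slice).  Let `𝒟` be a down-closed family of at most `h + h` subsets of `Fin h`; let the layout have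
injective rows `u i` of size `≤ 2` and, as (injective) columns, all of `𝒟`; and let it be
UNION-LABELLED: `⋃_{a ∈ u i} L a = w i` for some `L`, with distinct labels inside each row.  Then
ONE explicit product of `h + h` affine forms — the indicator forms `1 + Σ_{c∈V} y_c + Σ_{a : L a = V} x_a`,
`V ∈ 𝒟`, padded with constants — makes the partition minor nonsingular. -/
theorem chowHits_thinRows_of_unionLabelling (h : ℕ) (DD : Finset (Finset (Fin h)))
    (hDD : ∀ W ∈ DD, ∀ U : Finset (Fin h), U ⊆ W → U ∈ DD) (hcard : DD.card ≤ h + h)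
    (r : ℕ) (u w : Fin r → Finset (Fin h)) (hw : Function.Injective w)
    (hu2 : ∀ i, (u i).card ≤ 2) (hwD : ∀ j, w j ∈ DD) (hsurj : ∀ V ∈ DD, ∃ j, w j = V)
    (L : Fin h → Finset (Fin h)) (hLab : ∀ i, (u i).biUnion L = w i)
    (hLinj : ∀ i, ∀ a ∈ u i, ∀ b ∈ u i, L a = L b → a = b) :
    ∃ ℓ : Fin (h + h) → MvPolynomial (Fin (h + h)) ℂ, (∀ k, (ℓ k).totalDegree ≤ 1) ∧
      (Matrix.of fun i j : Fin r => MvPolynomial.coeff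
        (∑ a ∈ u i, Finsupp.single (Fin.castAdd h a) 1 +
          ∑ c ∈ w j, Finsupp.single (Fin.natAdd h c) 1) (∏ k, ℓ k)).det ≠ 0 := by
  classical
  set κ : Fin h → Finset (Fin h) → ℂ := fun a V => if V = L a then (1 : ℂ) else 0 with hκ
  -- the forms and their embedding into `Fin (h + h)`
  obtain ⟨ℓ, hℓdeg, hℓprod⟩ := exists_forms_of_card_le DD hcard
    (fun V => C 1 + ∑ a, C (κ a V) * X (Fin.castAdd h a) +
      ∑ c, C (if c ∈ V then (1 : ℂ) else 0) * X (Fin.natAdd h c))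
    (fun V _ => by
      have e : (C 1 + ∑ a, C (κ a V) * X (Fin.castAdd h a) +
          ∑ c, C (if c ∈ V then (1 : ℂ) else 0) * X (Fin.natAdd h c) : MvPolynomial (Fin (h + h)) ℂ) =
          C 1 + ∑ v : Fin (h + h), C (Fin.append (fun a => κ a V)
            (fun c => if c ∈ V then (1 : ℂ) else 0) v) * X v := by
        rw [Fin.sum_univ_add]
        simp only [Fin.append_left, Fin.append_right, add_assoc]
      rw [e]
      exact totalDegree_affine_le _ _)
  refine ⟨ℓ, hℓdeg, ?_⟩
  rw [hℓprod]
  -- sort the columns by cardinality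
  set σ : Equiv.Perm (Fin r) := Tuple.sort fun j => (w j).card with hσ
  have hmono : Monotone fun j => (w (σ j)).card := Tuple.monotone_sort fun j => (w j).card
  have hdet := det_xdiag_ne_zero_of_monotone DD hDD r (u ∘ σ) (w ∘ σ)
    (hw.comp σ.injective) (fun i => hu2 (σ i)) (fun j => hwD (σ j))
    (fun V hV => by
      obtain ⟨j, hj⟩ := hsurj V hV
      exact ⟨σ.symm j, by simp [hj]⟩)
    hmono L (fun i => hLab (σ i)) (fun i => hLinj (σ i))
  intro hzero
  apply hdet
  rw [← Matrix.det_submatrix_equiv_self σ] at hzero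
  refine Eq.trans ?_ hzero
  congr 1

/-- **PRINCIPAL THIN MINORS ON GRAPH COMPLEXES, every height.**  Let `𝒰 = (u i)_i` be an injective
family of `r ≤ h + h` subsets of `Fin h` of size `≤ 2` that is down-closed (a graph complex: with an
edge it contains its vertices and `∅`).  Then the PRINCIPAL partition minor `[𝒰, 𝒰]` is Chow-hit:
ONE product of `h + h` affine forms (the indicator forms `1 + y_S + Σ_{a : {a} = S} x_a`, `S ∈ 𝒰`)
makes `det[coeff (E (u i) (u j)) ∏ ℓ]` nonzero (labels `L a = {a}`). -/
theorem chowHits_principalThinMinors_of_downClosed (h : ℕ) (r : ℕ) (hr : r ≤ h + h)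
    (u : Fin r → Finset (Fin h)) (hu : Function.Injective u) (hu2 : ∀ i, (u i).card ≤ 2)
    (hdown : ∀ i (U : Finset (Fin h)), U ⊆ u i → ∃ i', u i' = U) :
    ∃ ℓ : Fin (h + h) → MvPolynomial (Fin (h + h)) ℂ, (∀ k, (ℓ k).totalDegree ≤ 1) ∧
      (Matrix.of fun i j : Fin r => MvPolynomial.coeff
        (∑ a ∈ u i, Finsupp.single (Fin.castAdd h a) 1 +
          ∑ c ∈ u j, Finsupp.single (Fin.natAdd h c) 1) (∏ k, ℓ k)).det ≠ 0 := by
  classical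
  refine chowHits_thinRows_of_unionLabelling h (Finset.univ.image u) ?_ ?_ r u u hu hu2
    (fun j => Finset.mem_image_of_mem u (Finset.mem_univ j)) ?_ (fun a => {a}) ?_ ?_
  · intro W hW U hU
    obtain ⟨j, -, rfl⟩ := Finset.mem_image.mp hW
    obtain ⟨j', hj'⟩ := hdown j U hU
    exact Finset.mem_image.mpr ⟨j', Finset.mem_univ _, hj'⟩
  · calc (Finset.univ.image u).card ≤ (Finset.univ : Finset (Fin r)).card := Finset.card_image_le
      _ = r := by rw [Finset.card_univ, Fintype.card_fin]
      _ ≤ h + h := hr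
  · intro V hV
    obtain ⟨j, -, hj⟩ := Finset.mem_image.mp hV
    exact ⟨j, hj⟩
  · intro i
    exact Finset.biUnion_singleton_eq_self
  · intro i a _ b _ e
    exact Finset.singleton_injective e

/-- **Union-labelled layouts, arbitrary enumerations.**  As `chowHits_thinRows_of_unionLabelling`,
but the rows need not be indexed compatibly with the columns: it suffices that the label-unions
`⋃_{a ∈ u i} L a` are pairwise distinct members of `𝒟` (the columns being all of `𝒟`); the matching
row permutation is constructed here (`Matrix.det_permute`). -/
theorem chowHits_thinRows_of_unionLabelling' (h : ℕ) (DD : Finset (Finset (Fin h)))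
    (hDD : ∀ W ∈ DD, ∀ U : Finset (Fin h), U ⊆ W → U ∈ DD) (hcard : DD.card ≤ h + h)
    (r : ℕ) (u w : Fin r → Finset (Fin h)) (hw : Function.Injective w)
    (hu2 : ∀ i, (u i).card ≤ 2) (hwD : ∀ j, w j ∈ DD) (hsurj : ∀ V ∈ DD, ∃ j, w j = V)
    (L : Fin h → Finset (Fin h)) (hLabD : ∀ i, (u i).biUnion L ∈ DD)
    (hLabInj : ∀ i i', (u i).biUnion L = (u i').biUnion L → i = i')
    (hLinj : ∀ i, ∀ a ∈ u i, ∀ b ∈ u i, L a = L b → a = b) :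
    ∃ ℓ : Fin (h + h) → MvPolynomial (Fin (h + h)) ℂ, (∀ k, (ℓ k).totalDegree ≤ 1) ∧
      (Matrix.of fun i j : Fin r => MvPolynomial.coeff
        (∑ a ∈ u i, Finsupp.single (Fin.castAdd h a) 1 +
          ∑ c ∈ w j, Finsupp.single (Fin.natAdd h c) 1) (∏ k, ℓ k)).det ≠ 0 := by
  classical
  -- match every column to the row carrying its label
  have hcol : ∀ i, ∃ j, w j = (u i).biUnion L := fun i => hsurj _ (hLabD i)
  choose τ hτ using hcol
  have hτinj : Function.Injective τ := fun i i' e => hLabInj i i' (by rw [← hτ i, ← hτ i', e])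
  set τe : Equiv.Perm (Fin r) := Equiv.ofBijective τ (Finite.injective_iff_bijective.mp hτinj) with hτe
  -- rows re-indexed by `π := τe.symm`: row `π j` has label-union `w j`
  obtain ⟨ℓ, hℓdeg, hdet⟩ := chowHits_thinRows_of_unionLabelling h DD hDD hcard r (u ∘ τe.symm) w hw
    (fun i => hu2 _) hwD hsurj L
    (fun j => by
      have e := hτ (τe.symm j)
      have e' : τ (τe.symm j) = j := by
        have := τe.apply_symm_apply j
        rwa [hτe, Equiv.ofBijective_apply] at this
      rw [e'] at e
      simpa [Function.comp_apply] using e.symm)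
    (fun j => hLinj _)
  refine ⟨ℓ, hℓdeg, fun hzero => hdet ?_⟩
  have e1 : (Matrix.of fun i j : Fin r => MvPolynomial.coeff
      (∑ a ∈ (u ∘ τe.symm) i, Finsupp.single (Fin.castAdd h a) 1 +
        ∑ c ∈ w j, Finsupp.single (Fin.natAdd h c) 1) (∏ k, ℓ k)) =
      (Matrix.of fun i j : Fin r => MvPolynomial.coeff
        (∑ a ∈ u i, Finsupp.single (Fin.castAdd h a) 1 +
          ∑ c ∈ w j, Finsupp.single (Fin.natAdd h c) 1) (∏ k, ℓ k)).submatrix τe.symm id := by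
    ext i j
    simp only [Matrix.submatrix_apply, Matrix.of_apply, Function.comp_apply, id]
  rw [e1, Matrix.det_permute, hzero, mul_zero]

end Summit.ValiantsHypothesis.ValiantsHypothesis.Theorems.BarrierLever.ChowSubcube
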